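import Summits.QuantumFields.YangMills.Theorems.IR.LargeFieldRarityFiniteSize
import Summits.QuantumFields.YangMills.Theorems.IR.LargeFieldRarityEngine
import Summits.QuantumFields.YangMills.Theorems.EquipartitionCriticalityFreeEnergyLogCoefficient

/-!
# Large-field rarity package, file 5∕5: the outputs — (FE∞) from the tree's Chatterjee theorem, (CZ-odd) = the tree's odd-torus chessboard,
# and the HYPOTHESIS-FREE main theorem on the odd tori `≥ 3` above the floor `(⌈β⌉₊+2)²`

Landed for item `stmt-QuantumFields-19354` (`--supports … --as helper`) by the LEAD prover ab-p1 under director-ym RULING g9-№2 ∕ №14 (3)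
(critic ym-ir-crit-1 GATE 2026-08-28T03:18:39Z: supplier PROVED, land under `Theorems/IR/`); authored by ideator ym-ir-idea-4 g3, split of the
sorry-free workfile `Cruxes/IR/Lines/largefield_rarity_chessboard.lean` v8 per `Cruxes/IR/Lines/largefield_rarity_chessboard_LANDING.md`
(five files: `LargeFieldRarityDefs` → {`…FiniteSize`, `…Increment`} → `…Engine` → `…OddTori`).

Content: `freeEnergyThermo : FreeEnergyThermo` (from `Summit.QuantumFields.YangMills.Theorems.freeEnergyLogCoefficient_proof`, crux
`FreeEnergyLogCoefficient` of route `EquipartitionCriticality`, item 8759 closed·proved — hence this file's one Theses-cone import),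
`chessboardZRatio_odd : ChessboardZRatio {L | Odd L ∧ 3 ≤ L}` (= `OddTorusChessboard.wilsonExpectation_expObs_le_exp_card_all`),
★ `largeFieldRarity_oddSides : LargeFieldRarityOn {L | Odd L ∧ 3 ≤ L}`, `largeFieldRarityOddTori_holds : LargeFieldRarityOddTori`,
`largeFieldRarityFrom_of_oddTori` ∕ `largeFieldRarityFrom_holds'` (idea-5 g6's statement, second proof), `largeFieldRarity_even (hCB)`,
and modulo the typed residual (FE<): `largeFieldRarityAllOddTori_of_below`, `largeFieldRaritySmallTori_of_below`.

HONESTY.  Nothing here proves the Clay Yang–Mills mass gap, a lattice mass gap, `BalabanLadder.IR`, (T) or (M-b); R4 of the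
ladder closes only the conditional finite-𝕋⁴ rung `BalabanLadder.UV`.
-/

noncomputable section

open MeasureTheory Finset
open Literature.MathematicalPhysics.QuantumFieldTheory Literature.MathematicalPhysics.QuantumLattice
open Summit.QuantumFields.YangMills.Theorems (OddTorusChessboard.Orient OddTorusChessboard.wilsonExpectation_expObs_le_exp_card_all
  SoloBlind.expObs)

namespace Summit.QuantumFields.YangMills.Cruxes.IR.LargeFieldRarityChessboard

/-! ## §2 SEAM 0 (proved): the tree's Chatterjee theorem ⇒ (FE∞) -/

/-- **(FE∞) PROVED** from `freeEnergyLogCoefficient_proof` (`ν = 3D/2`, `β₃ = max(N₀, 1)` from the limit). -/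
theorem freeEnergyThermo : FreeEnergyThermo := by
  intro G _ _ _ _ hG
  letI : MeasurableSpace G := borel G
  haveI : BorelSpace G := ⟨rfl⟩
  intro r
  obtain ⟨K, hK⟩ := Summit.QuantumFields.YangMills.Theorems.freeEnergyLogCoefficient_proof G hG r
  obtain ⟨N₀, hN₀⟩ := (Metric.tendsto_atTop.1 hK) 1 one_pos
  refine ⟨3 * (Module.finrank ℝ ↥(Submodule.span ℝ {X : Matrix (Fin r.N) (Fin r.N) ℂ |
      ∀ t : ℝ, NormedSpace.exp ((t : ℂ) • X) ∈ Set.range r.ρ}) : ℝ) / 2, K, max N₀ 1,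
    lt_of_lt_of_le one_pos (le_max_right _ _), fun β hβ => ?_⟩
  have h := hN₀ β (le_trans (le_max_left _ _) hβ)
  rw [Real.dist_eq] at h
  exact h.le

/-! ## §6b (proved): (CZ-odd) IS the tree's odd-torus chessboard (ym-infvol-p3, 2026-08-27) -/

/-- **(CZ) on the odd sides `≥ 3`, PROVED**: `OddTorusChessboard.wilsonExpectation_expObs_le_exp_card_all` (Hölder over the
`m = 6` orientations + the odd-torus one-orientation chessboard from the MIXED site|link reflections, Borgs–Seiler) is exactly
`ChessboardZRatio {L | Odd L ∧ 3 ≤ L}` with `k = m`, `θ = 1/(2m)`, after `∏ e^{λβ s_p} = e^{λβ Σ s_p}`. -/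
theorem chessboardZRatio_odd : ChessboardZRatio {L | Odd L ∧ 3 ≤ L} := by
  intro G _ _ _ _
  letI : MeasurableSpace G := borel G
  haveI : BorelSpace G := ⟨rfl⟩
  intro r
  have hmpos : 0 < Fintype.card (OddTorusChessboard.Orient 4) :=
    Fintype.card_pos_iff.2 ⟨⟨((0 : Fin 4), (1 : Fin 4)), by decide⟩⟩
  set m : ℕ := Fintype.card (OddTorusChessboard.Orient 4) with hm
  have hmR : (0 : ℝ) < m := by exact_mod_cast hmpos
  have hm1 : (1 : ℝ) ≤ m := by exact_mod_cast hmpos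
  have hθ : (m : ℝ) * (1 / (2 * m)) = 1 / 2 := by field_simp
  refine ⟨m, 1 / (2 * m), by positivity, hm1, by rw [hθ]; norm_num, ?_⟩
  intro L _ hL β hβ lam hlam hlamθ Q
  obtain ⟨hLodd, hL3⟩ := hL
  have hc : 0 ≤ lam * β := mul_nonneg hlam.le hβ
  have hmlam : (m : ℝ) * lam ≤ 1 := by
    have h := mul_le_mul_of_nonneg_left hlamθ hmR.le
    rw [hθ] at h
    linarith
  have hmc : (m : ℝ) * (lam * β) ≤ β := by
    calc (m : ℝ) * (lam * β) = (m * lam) * β := by ring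
      _ ≤ 1 * β := mul_le_mul_of_nonneg_right hmlam hβ
      _ = β := one_mul β
  have key := OddTorusChessboard.wilsonExpectation_expObs_le_exp_card_all (d := 4) (L := L) r.ρ hLodd hL3 r.continuous
    hc hmc hmpos Q
  have hlhs : ∫ U, ∏ p ∈ Q, Real.exp (lam * β * plaqCost r.ρ U p) ∂(wilsonMeasure (d := 4) (L := L) r.ρ β) =
      wilsonExpectation r.ρ β (SoloBlind.expObs r.ρ (lam * β) Q) := by
    unfold wilsonExpectation SoloBlind.expObs
    congr 1
    funext U
    rw [Finset.mul_sum, Real.exp_sum]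
    rfl
  rw [hlhs]
  refine key.trans (le_of_eq ?_)
  congr 1
  rw [show β - (m : ℝ) * (lam * β) = (1 - m * lam) * β by ring, mul_comm]

/-! ## §7 Outputs of the engine — THEOREMS (no hypotheses on the odd sides; (CB) as a hypothesis on the even sides) -/

/-- `LargeFieldRarityEven` is `LargeFieldRarityOn` at the even sides (definitional). -/
theorem largeFieldRarityEven_of_on {fl : ℝ → ℕ} (h : LargeFieldRarityOnFrom {L | Even L} fl) : LargeFieldRarityEvenFrom fl := by
  intro G _ _ _ _ hG
  letI : MeasurableSpace G := borel G
  haveI : BorelSpace G := ⟨rfl⟩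
  intro r
  obtain ⟨c, A₀, β₃, hc, hh⟩ := h G hG r
  exact ⟨c, A₀, β₃, hc, fun A hA β hβ L _ hLe hL Q => hh A hA β hβ L hLe hL Q⟩

/-- **MAIN THEOREM (odd tori of the literal crux; no hypotheses, no `sorry`)**: fixed-`A`, β-uniform, Peierls-multiplicative
large-field rarity on every odd torus `L ≥ max(3, (⌈β⌉₊+2)²)`, for every compact simple `G` — reflection positivity by the tree's
odd-torus chessboard, β-uniformity by the tree's Chatterjee theorem + (FS).  Versus LINE 3's literal `stub_largeFieldRarity`
(= `LargeFieldRarityOdd`): `∃ A₀ ∀ A ≥ A₀` with one rate instead of `∀ A > 0 ∃ c`, sides `≥ 3`, and the volume floor `(⌈β⌉₊+2)²`;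
all three are what a Peierls count of SPARSE defects on tori `≥ M₁(β)` consumes (recommended re-typing of LINE 3's (R)). -/
theorem largeFieldRarity_oddSides : LargeFieldRarityOn {L | Odd L ∧ 3 ≤ L} :=
  largeFieldRarityOn_of_ZRatio chessboardZRatio_odd (freeEnergyIncrement_of_thermo freeEnergyThermo finiteSizeFreeEnergy)

/-- **MAIN THEOREM, explicit form in the crux's parametrisation `𝕋⁴_{2S+1}`, `S ≥ 1`** (witness of `LargeFieldRarityOddTori`). -/
theorem largeFieldRarityOddTori_holds : LargeFieldRarityOddTori := by
  intro G _ _ _ _ hG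
  letI : MeasurableSpace G := borel G
  haveI : BorelSpace G := ⟨rfl⟩
  intro r
  obtain ⟨c, A₀, β₃, hc, hh⟩ := largeFieldRarity_oddSides G hG r
  refine ⟨c, A₀, β₃, hc, fun A hA β hβ S hS hL Q => ?_⟩
  exact hh A hA β hβ (2 * S + 1) ⟨⟨S, rfl⟩, by omega⟩ hL Q

/-- `LargeFieldRarityOddTori → LargeFieldRarityFrom` (`S₁ β := max 1 (volFloor β)`; `plaqCost = plaquetteCost` is `rfl`). -/
theorem largeFieldRarityFrom_of_oddTori (h : LargeFieldRarityOddTori) : LargeFieldRarityFrom := by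
  intro G _ _ _ _ hG
  letI : MeasurableSpace G := borel G
  haveI : BorelSpace G := ⟨rfl⟩
  intro r
  obtain ⟨c, A₀, β₃, hc, hh⟩ := h G hG r
  refine ⟨A₀, fun A hA => ⟨c, β₃, fun β => max 1 (volFloor β), hc, fun β hβ S hS Q => ?_⟩⟩
  have hS1 : 1 ≤ S := le_trans (le_max_left _ _) hS
  have hSf : volFloor β ≤ 2 * S + 1 := by have := le_trans (le_max_right _ _) hS; omega
  exact hh A hA.le β hβ S hS1 hSf Q

/-- Hence `LargeFieldRarityFrom` holds (second, independent proof of idea-5's statement). -/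
theorem largeFieldRarityFrom_holds' : LargeFieldRarityFrom :=
  largeFieldRarityFrom_of_oddTori largeFieldRarityOddTori_holds

/-- **Even sides (e.g. the class-parametric leg's `familySides`), from an even indicator chessboard (CB) as hypothesis.** -/
theorem largeFieldRarity_even (hCB : ChessboardEvents) : LargeFieldRarityEven :=
  largeFieldRarityEven_of hCB (expMomentBound_of_increment (freeEnergyIncrement_of_thermo freeEnergyThermo finiteSizeFreeEnergy))

/-! ## §8 Below the floor: what the typed residual (FE<) buys — LINE 3's (R) on ALL odd tori `≥ 3` -/

/-- **(FE<) ⇒ LINE 3's (R) on ALL odd tori `≥ 3`** — the same engine with floor `0`: `chessboardZRatio_odd` +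
`largeFieldRarityOn_of_ZRatio` + `freeEnergyIncrementFrom_zero_of_below`.  So (R<) — and with it the whole of LINE 3's (R) — REDUCES
BY NAME to the free-energy statement (FE<). -/
theorem largeFieldRarityAllOddTori_of_below (hB : FreeEnergyIncrementBelow) : LargeFieldRarityAllOddTori := by
  have h : LargeFieldRarityOnFrom {L | Odd L ∧ 3 ≤ L} (fun _ => 0) :=
    largeFieldRarityOn_of_ZRatio chessboardZRatio_odd
      (freeEnergyIncrementFrom_zero_of_below (freeEnergyIncrement_of_thermo freeEnergyThermo finiteSizeFreeEnergy) hB)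
  intro G _ _ _ _ hG
  letI : MeasurableSpace G := borel G
  haveI : BorelSpace G := ⟨rfl⟩
  intro r
  obtain ⟨c, A₀, β₃, hc, hh⟩ := h G hG r
  refine ⟨c, A₀, β₃, hc, fun A hA β hβ S hS Q => ?_⟩
  haveI : NeZero (2 * S + 1) := ⟨by omega⟩
  have hmem : (2 * S + 1) ∈ {L : ℕ | Odd L ∧ 3 ≤ L} := ⟨⟨S, by ring⟩, by omega⟩
  exact hh A hA β hβ (2 * S + 1) hmem (Nat.zero_le _) Q

/-- (FE<) ⇒ (R<) in particular. -/
theorem largeFieldRaritySmallTori_of_below (hB : FreeEnergyIncrementBelow) : LargeFieldRaritySmallTori := by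
  intro G _ _ _ _ hG
  letI : MeasurableSpace G := borel G
  haveI : BorelSpace G := ⟨rfl⟩
  intro r
  obtain ⟨c, A₀, β₃, hc, hh⟩ := largeFieldRarityAllOddTori_of_below hB G hG r
  exact ⟨c, A₀, β₃, hc, fun A hA β hβ S hS _ Q => hh A hA β hβ S hS Q⟩

end Summit.QuantumFields.YangMills.Cruxes.IR.LargeFieldRarityChessboard

end
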